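import Literature.Combinatorics.Enumerative.CycleIndexSum
import Mathlib.Analysis.Normed.Ring.InfiniteSum
import Mathlib.Analysis.SpecificLimits.Normed
import Mathlib.Topology.Algebra.InfiniteSum.NatInt
import Mathlib.Topology.Algebra.InfiniteSum.Real
import HarnessLib

/-!
# The tilted cycle-index measure: mean, variance and a Chebyshev window bound

For a bounded nonnegative sequence `y₁, y₂, …` and `0 < s < 1` consider the weights
`a_m = C_m(y) s^m` (`m ≥ 0`), where `C_m(y)` is the cycle-index sum of
`Literature/Combinatorics/Enumerative/CycleIndexSum.lean` (in the free Bose gas: the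
grand-canonical law, at fugacity `s`, of the number of particles outside the zero mode). From the
recursion `m C_m = ∑_{j=1}^{m} y_j C_{m-j}` one gets `m a_m = ∑_{i+k=m-1} v_i a_k` with
`v_i = y_{i+1} s^{i+1}`, whence by Cauchy products (everything is absolutely summable because
`C_m(y) ≤ (m+1)^K`; the hypotheses `0 ≤ y_j ≤ K` are imposed for `j > 0` only, `K : ℕ`):

* `tsum_mul_tiltedWeight`: `∑_m m a_m = W · A`, with `A = ∑_m a_m`, `W = ∑_i v_i = ∑_j y_j s^j`;
* `tsum_sq_mul_tiltedWeight`: `∑_m m² a_m = (W² + W₂) · A`, `W₂ = ∑_i (i+1) v_i = ∑_j j y_j s^j`;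
* `tsum_sq_sub_mul_tiltedWeight`: `∑_m (m - W)² a_m = W₂ · A` (the variance is `W₂`);
* `tiltedWeight_window`: Chebyshev — if `[W - t, W + t] ⊆ [M, N]` then
  `∑_{M ≤ m ≤ N} a_m ≥ A (1 - W₂/t²)`.

In generating functions: `∑_m a_m z^m = exp(∑_j y_j (sz)^j / j)`, and the two identities are
`(z∂_z) log` and `(z∂_z)² log` of it at `z = 1`. All [folklore].
-/

noncomputable section

open Finset Filter
open scoped BigOperators Topology

namespace Literature.Combinatorics.Enumerative.CycleIndexSum

/-- The tilted weight `a_m = C_m(y) s^m`. [folklore] -/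
def tiltedWeight (y : ℕ → ℝ) (s : ℝ) (m : ℕ) : ℝ := cycleIndexSum y m * s ^ m

/-- The shifted kernel `v_i = y_{i+1} s^{i+1}`. [folklore] -/
def tiltKernel (y : ℕ → ℝ) (s : ℝ) (i : ℕ) : ℝ := y (i + 1) * s ^ (i + 1)

section

variable {y : ℕ → ℝ} {K : ℕ} {s : ℝ}

/-- `a_m ≥ 0`. [folklore] -/
theorem tiltedWeight_nonneg (hy0 : ∀ j, 0 < j → 0 ≤ y j) (hs0 : 0 ≤ s) (m : ℕ) :
    0 ≤ tiltedWeight y s m :=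
  mul_nonneg (cycleIndexSum_nonneg hy0 m) (pow_nonneg hs0 m)

/-- `a_0 = 1`. [folklore] -/
@[simp] theorem tiltedWeight_zero (y : ℕ → ℝ) (s : ℝ) : tiltedWeight y s 0 = 1 := by
  simp [tiltedWeight]

/-- `v_i ≥ 0`. [folklore] -/
theorem tiltKernel_nonneg (hy0 : ∀ j, 0 < j → 0 ≤ y j) (hs0 : 0 ≤ s) (i : ℕ) :
    0 ≤ tiltKernel y s i :=
  mul_nonneg (hy0 _ i.succ_pos) (pow_nonneg hs0 _)

/-- Summability of `(m+1)^p s^m` for `0 ≤ s < 1`. [folklore] -/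
theorem summable_pow_succ_mul_geometric (p : ℕ) (hs0 : 0 ≤ s) (hs1 : s < 1) :
    Summable fun m : ℕ => ((m : ℝ) + 1) ^ p * s ^ m := by
  rcases eq_or_lt_of_le hs0 with rfl | hs
  · refine summable_of_ne_finset_zero (s := {0}) fun m hm => ?_
    have : m ≠ 0 := by simpa using hm
    simp [zero_pow this]
  · have h := summable_pow_mul_geometric_of_norm_lt_one p (r := s)
      (by rwa [Real.norm_of_nonneg hs0])
    have h' := (summable_nat_add_iff 1).mpr h
    have h'' := h'.mul_left s⁻¹
    refine h''.congr fun m => ?_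
    simp only [Nat.cast_add, Nat.cast_one, pow_succ]
    field_simp

/-- **Summability of the moments** `∑_m (m+1)^p a_m < ∞` (`0 ≤ y_j ≤ K`, `0 ≤ s < 1`), from the
polynomial growth `C_m(y) ≤ (m+1)^K`. [folklore] -/
theorem summable_pow_mul_tiltedWeight (hy0 : ∀ j, 0 < j → 0 ≤ y j) (hyK : ∀ j, 0 < j → y j ≤ K)
    (hs0 : 0 ≤ s)
    (hs1 : s < 1) (p : ℕ) : Summable fun m : ℕ => ((m : ℝ) + 1) ^ p * tiltedWeight y s m := by
  refine (summable_pow_succ_mul_geometric (p + K) hs0 hs1).of_nonneg_of_le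
    (fun m => mul_nonneg (by positivity) (tiltedWeight_nonneg hy0 hs0 m)) fun m => ?_
  unfold tiltedWeight
  rw [pow_add, mul_assoc]
  gcongr
  exact cycleIndexSum_le_pow hy0 hyK m

/-- `∑_m a_m < ∞`. [folklore] -/
theorem summable_tiltedWeight (hy0 : ∀ j, 0 < j → 0 ≤ y j) (hyK : ∀ j, 0 < j → y j ≤ K)
    (hs0 : 0 ≤ s)
    (hs1 : s < 1) : Summable (tiltedWeight y s) := by
  simpa using summable_pow_mul_tiltedWeight hy0 hyK hs0 hs1 0

/-- `∑_m m a_m < ∞`. [folklore] -/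
theorem summable_mul_tiltedWeight (hy0 : ∀ j, 0 < j → 0 ≤ y j) (hyK : ∀ j, 0 < j → y j ≤ K)
    (hs0 : 0 ≤ s)
    (hs1 : s < 1) : Summable fun m : ℕ => (m : ℝ) * tiltedWeight y s m := by
  refine (summable_pow_mul_tiltedWeight hy0 hyK hs0 hs1 1).of_nonneg_of_le
    (fun m => mul_nonneg (by positivity) (tiltedWeight_nonneg hy0 hs0 m)) fun m => ?_
  rw [pow_one]
  gcongr
  · exact tiltedWeight_nonneg hy0 hs0 m
  · linarith

/-- `∑_m m² a_m < ∞`. [folklore] -/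
theorem summable_sq_mul_tiltedWeight (hy0 : ∀ j, 0 < j → 0 ≤ y j) (hyK : ∀ j, 0 < j → y j ≤ K)
    (hs0 : 0 ≤ s)
    (hs1 : s < 1) : Summable fun m : ℕ => (m : ℝ) ^ 2 * tiltedWeight y s m := by
  refine (summable_pow_mul_tiltedWeight hy0 hyK hs0 hs1 2).of_nonneg_of_le
    (fun m => mul_nonneg (by positivity) (tiltedWeight_nonneg hy0 hs0 m)) fun m => ?_
  gcongr
  · exact tiltedWeight_nonneg hy0 hs0 m
  · linarith

/-- `∑_i v_i < ∞` (`v_i ≤ K s^{i+1}`). [folklore] -/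
theorem summable_tiltKernel (hy0 : ∀ j, 0 < j → 0 ≤ y j) (hyK : ∀ j, 0 < j → y j ≤ K) (hs0 : 0 ≤ s)
    (hs1 : s < 1) : Summable (tiltKernel y s) := by
  have h : Summable fun i : ℕ => (K : ℝ) * s ^ (i + 1) := by
    have := ((summable_geometric_of_lt_one hs0 hs1).mul_left ((K : ℝ) * s))
    refine this.congr fun i => ?_
    rw [pow_succ]; ring
  refine h.of_nonneg_of_le (tiltKernel_nonneg hy0 hs0) fun i => ?_
  unfold tiltKernel
  gcongr
  exact hyK _ i.succ_pos

/-- `∑_i (i+1) v_i < ∞`. [folklore] -/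
theorem summable_succ_mul_tiltKernel (hy0 : ∀ j, 0 < j → 0 ≤ y j) (hyK : ∀ j, 0 < j → y j ≤ K)
    (hs0 : 0 ≤ s)
    (hs1 : s < 1) : Summable fun i : ℕ => ((i : ℝ) + 1) * tiltKernel y s i := by
  have h : Summable fun i : ℕ => ((i : ℝ) + 1) ^ 1 * s ^ i * ((K : ℝ) * s) :=
    (summable_pow_succ_mul_geometric 1 hs0 hs1).mul_right _
  refine h.of_nonneg_of_le (fun i => mul_nonneg (by positivity) (tiltKernel_nonneg hy0 hs0 i))
    fun i => ?_
  unfold tiltKernel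
  rw [pow_one, pow_succ]
  have := hyK (i + 1) i.succ_pos
  have := hy0 (i + 1) i.succ_pos
  have : (0 : ℝ) ≤ s ^ i := pow_nonneg hs0 i
  calc ((i : ℝ) + 1) * (y (i + 1) * (s ^ i * s)) = (((i : ℝ) + 1) * s ^ i) * (y (i + 1) * s) := by
        ring
    _ ≤ (((i : ℝ) + 1) * s ^ i) * ((K : ℝ) * s) := by gcongr

/-- **The tilted recursion**: `(n+1) a_{n+1} = ∑_{i+k=n} v_i a_k`. [folklore] -/
theorem succ_mul_tiltedWeight_succ (y : ℕ → ℝ) (s : ℝ) (n : ℕ) :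
    ((n : ℝ) + 1) * tiltedWeight y s (n + 1) =
      ∑ kl ∈ Finset.antidiagonal n, tiltKernel y s kl.1 * tiltedWeight y s kl.2 := by
  have hrec := cycleIndexSum_rec y (n + 1)
  rw [Finset.Nat.sum_antidiagonal_eq_sum_range_succ
    (fun i k => tiltKernel y s i * tiltedWeight y s k)]
  unfold tiltedWeight tiltKernel
  have hcast : ((n : ℝ) + 1) = ((n + 1 : ℕ) : ℝ) := by push_cast; ring
  rw [hcast, ← mul_assoc, hrec, Finset.sum_mul]
  have hI : Finset.Icc 1 (n + 1) = Finset.Ico 1 (n + 1 + 1) := rfl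
  rw [hI, Finset.sum_Ico_eq_sum_range, show n + 1 + 1 - 1 = n.succ from rfl]
  refine Finset.sum_congr rfl fun k hk => ?_
  have hkn : k ≤ n := Nat.lt_succ_iff.mp (Finset.mem_range.mp hk)
  have h2 : n + 1 - (1 + k) = n - k := by omega
  rw [h2, show 1 + k = k + 1 from Nat.add_comm 1 k]
  have h3 : s ^ (n + 1) = s ^ (k + 1) * s ^ (n - k) := by
    rw [← pow_add]
    congr 1
    omega
  rw [h3]
  ring

/-- The total mass `A = ∑_m a_m`. [folklore] -/
def tiltMass (y : ℕ → ℝ) (s : ℝ) : ℝ := ∑' m : ℕ, tiltedWeight y s m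

/-- The mean `W = ∑_i v_i = ∑_{j ≥ 1} y_j s^j`. [folklore] -/
def tiltMean (y : ℕ → ℝ) (s : ℝ) : ℝ := ∑' i : ℕ, tiltKernel y s i

/-- The variance `W₂ = ∑_i (i+1) v_i = ∑_{j ≥ 1} j y_j s^j`. [folklore] -/
def tiltVar (y : ℕ → ℝ) (s : ℝ) : ℝ := ∑' i : ℕ, ((i : ℝ) + 1) * tiltKernel y s i

/-- `A ≥ 1` (the term `a_0 = 1`). [folklore] -/
theorem one_le_tiltMass (hy0 : ∀ j, 0 < j → 0 ≤ y j) (hyK : ∀ j, 0 < j → y j ≤ K) (hs0 : 0 ≤ s)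
    (hs1 : s < 1) :
    1 ≤ tiltMass y s := by
  unfold tiltMass
  rw [(summable_tiltedWeight hy0 hyK hs0 hs1).tsum_eq_zero_add, tiltedWeight_zero]
  have : 0 ≤ ∑' m : ℕ, tiltedWeight y s (m + 1) :=
    tsum_nonneg fun m => tiltedWeight_nonneg hy0 hs0 _
  linarith

/-- `A > 0`. [folklore] -/
theorem tiltMass_pos (hy0 : ∀ j, 0 < j → 0 ≤ y j) (hyK : ∀ j, 0 < j → y j ≤ K) (hs0 : 0 ≤ s)
    (hs1 : s < 1) :
    0 < tiltMass y s :=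
  lt_of_lt_of_le one_pos (one_le_tiltMass hy0 hyK hs0 hs1)

/-- `W ≥ 0`. [folklore] -/
theorem tiltMean_nonneg (hy0 : ∀ j, 0 < j → 0 ≤ y j) (hs0 : 0 ≤ s) : 0 ≤ tiltMean y s :=
  tsum_nonneg (tiltKernel_nonneg hy0 hs0)

/-- `W₂ ≥ 0`. [folklore] -/
theorem tiltVar_nonneg (hy0 : ∀ j, 0 < j → 0 ≤ y j) (hs0 : 0 ≤ s) : 0 ≤ tiltVar y s :=
  tsum_nonneg fun i => mul_nonneg (by positivity) (tiltKernel_nonneg hy0 hs0 i)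

/-- A finite part of the mass is at most the mass. [folklore] -/
theorem sum_tiltedWeight_le_tiltMass (hy0 : ∀ j, 0 < j → 0 ≤ y j) (hyK : ∀ j, 0 < j → y j ≤ K)
    (hs0 : 0 ≤ s)
    (hs1 : s < 1) (S : Finset ℕ) : ∑ m ∈ S, tiltedWeight y s m ≤ tiltMass y s :=
  (summable_tiltedWeight hy0 hyK hs0 hs1).sum_le_tsum S fun m _ => tiltedWeight_nonneg hy0 hs0 m

/-- Norm-summability of a nonnegative summable real sequence. [folklore] -/
theorem summable_norm_of_nonneg {f : ℕ → ℝ} (hf : Summable f) (h0 : ∀ n, 0 ≤ f n) :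
    Summable fun n => ‖f n‖ :=
  hf.congr fun n => (Real.norm_of_nonneg (h0 n)).symm

/-- **First moment**: `∑_m m a_m = W · A`. [folklore] -/
theorem tsum_mul_tiltedWeight (hy0 : ∀ j, 0 < j → 0 ≤ y j) (hyK : ∀ j, 0 < j → y j ≤ K)
    (hs0 : 0 ≤ s)
    (hs1 : s < 1) :
    ∑' m : ℕ, (m : ℝ) * tiltedWeight y s m = tiltMean y s * tiltMass y s := by
  have hA := summable_tiltedWeight hy0 hyK hs0 hs1
  have hV := summable_tiltKernel hy0 hyK hs0 hs1
  rw [(summable_mul_tiltedWeight hy0 hyK hs0 hs1).tsum_eq_zero_add]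
  simp only [Nat.cast_zero, zero_mul, zero_add, Nat.cast_add, Nat.cast_one]
  have hC : tiltMean y s * tiltMass y s =
      ∑' n : ℕ, ∑ kl ∈ Finset.antidiagonal n, tiltKernel y s kl.1 * tiltedWeight y s kl.2 :=
    tsum_mul_tsum_eq_tsum_sum_antidiagonal_of_summable_norm
      (summable_norm_of_nonneg hV (tiltKernel_nonneg hy0 hs0))
      (summable_norm_of_nonneg hA (tiltedWeight_nonneg hy0 hs0))
  rw [hC]
  exact tsum_congr fun n => succ_mul_tiltedWeight_succ y s n

/-- **Second moment**: `∑_m m² a_m = (W² + W₂) · A`. [folklore] -/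
theorem tsum_sq_mul_tiltedWeight (hy0 : ∀ j, 0 < j → 0 ≤ y j) (hyK : ∀ j, 0 < j → y j ≤ K)
    (hs0 : 0 ≤ s)
    (hs1 : s < 1) :
    ∑' m : ℕ, (m : ℝ) ^ 2 * tiltedWeight y s m =
      (tiltMean y s ^ 2 + tiltVar y s) * tiltMass y s := by
  have hA := summable_tiltedWeight hy0 hyK hs0 hs1
  have hV := summable_tiltKernel hy0 hyK hs0 hs1
  have hV2 := summable_succ_mul_tiltKernel hy0 hyK hs0 hs1
  have hMA := summable_mul_tiltedWeight hy0 hyK hs0 hs1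
  rw [(summable_sq_mul_tiltedWeight hy0 hyK hs0 hs1).tsum_eq_zero_add]
  simp only [Nat.cast_zero, ne_eq, OfNat.ofNat_ne_zero, not_false_eq_true, zero_pow, zero_mul,
    zero_add, Nat.cast_add, Nat.cast_one]
  have key : ∀ n : ℕ, ((n : ℝ) + 1) ^ 2 * tiltedWeight y s (n + 1) =
      ∑ kl ∈ Finset.antidiagonal n,
          ((kl.1 : ℝ) + 1) * tiltKernel y s kl.1 * tiltedWeight y s kl.2 +
        ∑ kl ∈ Finset.antidiagonal n,
          tiltKernel y s kl.1 * ((kl.2 : ℝ) * tiltedWeight y s kl.2) := by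
    intro n
    rw [sq, mul_assoc, succ_mul_tiltedWeight_succ, Finset.mul_sum, ← Finset.sum_add_distrib]
    refine Finset.sum_congr rfl fun kl hkl => ?_
    have h := Finset.mem_antidiagonal.mp hkl
    have hc : ((n : ℝ) + 1) = ((kl.1 : ℝ) + 1) + kl.2 := by
      rw [← h]; push_cast; ring
    rw [hc]
    ring
  have c1 : (∑' n : ℕ, ∑ kl ∈ Finset.antidiagonal n,
      ((kl.1 : ℝ) + 1) * tiltKernel y s kl.1 * tiltedWeight y s kl.2) =
      tiltVar y s * tiltMass y s :=
    (tsum_mul_tsum_eq_tsum_sum_antidiagonal_of_summable_norm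
      (summable_norm_of_nonneg hV2 fun i => mul_nonneg (by positivity)
    (tiltKernel_nonneg hy0 hs0 i))
      (summable_norm_of_nonneg hA (tiltedWeight_nonneg hy0 hs0))).symm
  have c2 : (∑' n : ℕ, ∑ kl ∈ Finset.antidiagonal n,
      tiltKernel y s kl.1 * ((kl.2 : ℝ) * tiltedWeight y s kl.2)) =
      tiltMean y s * (tiltMean y s * tiltMass y s) := by
    rw [← tsum_mul_tiltedWeight hy0 hyK hs0 hs1]
    exact (tsum_mul_tsum_eq_tsum_sum_antidiagonal_of_summable_norm
      (summable_norm_of_nonneg hV (tiltKernel_nonneg hy0 hs0))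
      (summable_norm_of_nonneg hMA fun m => mul_nonneg (by positivity)
        (tiltedWeight_nonneg hy0 hs0 m))).symm
  -- summability of the two Cauchy-product sequences
  have s1 : Summable fun n : ℕ => ∑ kl ∈ Finset.antidiagonal n,
      ((kl.1 : ℝ) + 1) * tiltKernel y s kl.1 * tiltedWeight y s kl.2 :=
    (summable_norm_sum_mul_antidiagonal_of_summable_norm
      (summable_norm_of_nonneg hV2 fun i => mul_nonneg (by positivity)
    (tiltKernel_nonneg hy0 hs0 i))
      (summable_norm_of_nonneg hA (tiltedWeight_nonneg hy0 hs0))).of_norm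
  have s2 : Summable fun n : ℕ => ∑ kl ∈ Finset.antidiagonal n,
      tiltKernel y s kl.1 * ((kl.2 : ℝ) * tiltedWeight y s kl.2) :=
    (summable_norm_sum_mul_antidiagonal_of_summable_norm
      (summable_norm_of_nonneg hV (tiltKernel_nonneg hy0 hs0))
      (summable_norm_of_nonneg hMA fun m => mul_nonneg (by positivity)
        (tiltedWeight_nonneg hy0 hs0 m))).of_norm
  rw [tsum_congr key, s1.tsum_add s2, c1, c2]
  ring

/-- **Variance identity**: `∑_m (m - W)² a_m = W₂ · A`. [folklore] -/
theorem tsum_sq_sub_mul_tiltedWeight (hy0 : ∀ j, 0 < j → 0 ≤ y j) (hyK : ∀ j, 0 < j → y j ≤ K)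
    (hs0 : 0 ≤ s)
    (hs1 : s < 1) :
    ∑' m : ℕ, ((m : ℝ) - tiltMean y s) ^ 2 * tiltedWeight y s m = tiltVar y s * tiltMass y s := by
  have hA := summable_tiltedWeight hy0 hyK hs0 hs1
  have hMA := summable_mul_tiltedWeight hy0 hyK hs0 hs1
  have hM2A := summable_sq_mul_tiltedWeight hy0 hyK hs0 hs1
  set W := tiltMean y s with hW
  have hexp : ∀ m : ℕ, ((m : ℝ) - W) ^ 2 * tiltedWeight y s m =
      (m : ℝ) ^ 2 * tiltedWeight y s m - 2 * W * ((m : ℝ) * tiltedWeight y s m) +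
        W ^ 2 * tiltedWeight y s m := fun m => by ring
  rw [tsum_congr hexp, ((hM2A.sub (hMA.mul_left (2 * W)))).tsum_add (hA.mul_left (W ^ 2)),
    hM2A.tsum_sub (hMA.mul_left (2 * W)), tsum_mul_left, tsum_mul_left,
    tsum_sq_mul_tiltedWeight hy0 hyK hs0 hs1, tsum_mul_tiltedWeight hy0 hyK hs0 hs1]
  unfold tiltMass
  ring

/-- **Chebyshev window bound**: if `[W - t, W + t] ⊆ [M, N]` then the tilted mass of
`[M, N]` is at least `(1 - W₂/t²) A`. [folklore] -/
theorem tiltedWeight_window (hy0 : ∀ j, 0 < j → 0 ≤ y j) (hyK : ∀ j, 0 < j → y j ≤ K) (hs0 : 0 ≤ s)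
    (hs1 : s < 1) {t : ℝ} (ht : 0 < t) {M N : ℕ} (hM : (M : ℝ) ≤ tiltMean y s - t)
    (hN : tiltMean y s + t ≤ N) :
    (1 - tiltVar y s / t ^ 2) * tiltMass y s ≤ ∑ m ∈ Finset.Icc M N, tiltedWeight y s m := by
  have hA := summable_tiltedWeight hy0 hyK hs0 hs1
  have hMA := summable_mul_tiltedWeight hy0 hyK hs0 hs1
  have hM2A := summable_sq_mul_tiltedWeight hy0 hyK hs0 hs1
  set W := tiltMean y s with hW
  set a := tiltedWeight y s with ha
  -- the mass outside the window
  set g : ℕ → ℝ := fun m => if m ∈ Finset.Icc M N then 0 else a m with hg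
  have hg0 : ∀ m, 0 ≤ g m := fun m => by
    simp only [hg]
    split_ifs
    · exact le_rfl
    · exact tiltedWeight_nonneg hy0 hs0 m
  have hga : ∀ m, g m ≤ a m := fun m => by
    simp only [hg]
    split_ifs
    · exact tiltedWeight_nonneg hy0 hs0 m
    · exact le_rfl
  have hgs : Summable g := hA.of_nonneg_of_le hg0 hga
  have hsplit : tiltMass y s = ∑ m ∈ Finset.Icc M N, a m + ∑' m, g m := by
    have hin : ∑' m : ℕ, (if m ∈ Finset.Icc M N then a m else 0) = ∑ m ∈ Finset.Icc M N, a m := by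
      rw [tsum_eq_sum (s := Finset.Icc M N) fun m hm => if_neg hm]
      exact Finset.sum_congr rfl fun m hm => if_pos hm
    have hsum_in : Summable fun m : ℕ => if m ∈ Finset.Icc M N then a m else 0 :=
      summable_of_ne_finset_zero (s := Finset.Icc M N) fun m hm => if_neg hm
    rw [← hin, ← hsum_in.tsum_add hgs]
    refine tsum_congr fun m => ?_
    simp only [hg]
    split_ifs <;> simp [ha]
  -- Chebyshev: outside the window `(m - W)² ≥ t²`
  have hcheb : ∀ m, g m ≤ ((m : ℝ) - W) ^ 2 / t ^ 2 * a m := by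
    intro m
    simp only [hg]
    split_ifs with hm
    · exact mul_nonneg (by positivity) (tiltedWeight_nonneg hy0 hs0 m)
    · have hout : t ^ 2 ≤ ((m : ℝ) - W) ^ 2 := by
        rw [Finset.mem_Icc, not_and_or, not_le, not_le] at hm
        rcases hm with hm | hm
        · have : (m : ℝ) + 1 ≤ M := by exact_mod_cast hm
          nlinarith
        · have : (N : ℝ) + 1 ≤ m := by exact_mod_cast hm
          nlinarith
      have h1 : 1 ≤ ((m : ℝ) - W) ^ 2 / t ^ 2 := by
        rw [le_div_iff₀ (by positivity)]; linarith
      calc a m = 1 * a m := (one_mul _).symm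
        _ ≤ ((m : ℝ) - W) ^ 2 / t ^ 2 * a m := by
          gcongr
          exact tiltedWeight_nonneg hy0 hs0 m
  have hs2 : Summable fun m : ℕ => ((m : ℝ) - W) ^ 2 / t ^ 2 * a m := by
    have : Summable fun m : ℕ => ((m : ℝ) - W) ^ 2 * a m := by
      have h := (hM2A.sub (hMA.mul_left (2 * W))).add (hA.mul_left (W ^ 2))
      refine h.congr fun m => ?_
      simp only [ha]
      ring
    refine (this.mul_left (1 / t ^ 2)).congr fun m => ?_
    ring
  have hout : ∑' m, g m ≤ tiltVar y s / t ^ 2 * tiltMass y s := by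
    calc ∑' m, g m ≤ ∑' m : ℕ, ((m : ℝ) - W) ^ 2 / t ^ 2 * a m := hgs.tsum_le_tsum hcheb hs2
      _ = (1 / t ^ 2) * ∑' m : ℕ, ((m : ℝ) - W) ^ 2 * a m := by
          rw [← tsum_mul_left]; exact tsum_congr fun m => by ring
      _ = tiltVar y s / t ^ 2 * tiltMass y s := by
          rw [ha, hW, tsum_sq_sub_mul_tiltedWeight hy0 hyK hs0 hs1]; ring
  rw [hsplit] at hout ⊢
  nlinarith [hout]

end

end Literature.Combinatorics.Enumerative.CycleIndexSum

end
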